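import Summits.QuantumFields.YangMills.Theorems.GradientFlowWitnessFlowedResponseFloorDefs

/-!
# BC3 skeleton for `GradientFlowWitness.FlowedResponseFloor` (item stmt-QuantumFields-25684) — v2, over the landed
# vocabulary `Theorems/GradientFlowWitnessFlowedResponseFloorDefs.lean` (p611644)

Two registered stubs and the kernel-checked composition, now stated over IMPORTABLE tree definitions
(namespace `Summit.QuantumFields.YangMills.Cruxes.FlowedResponseFloor.WindowSplit`):

* `stub_window : FlowedResponseFloorWindow` — the femto-window rung (BC5; prover record 2026-08-28: = the crux's
  transmutation wall in bounded-volume clothing, not a perturbative statement; see item evidence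
  `PROVER-RECORD-stub_window.md`);
* `stub_finiteSize : FlowedResponseFiniteSize` — β-uniform finite-size control of the response functional (W2 typed once);
* `FlowedResponseFloor_of : FlowedResponseFloor` — consumes both stubs BY NAME through the landed composition
  `flowedResponseFloor_of_window_of_finiteSize`.

A future stub file proves `theorem stub_window : FlowedResponseFloorWindow := …` (resp. `stub_finiteSize`) in this
namespace, importing the Defs module.  Nothing here is proved about NT or the mass gap; the two `sorry`s are the stubs.
-/

namespace Summit.QuantumFields.YangMills.Cruxes.FlowedResponseFloor.WindowSplit

/-- Stub 1 (BC5 rung): the femto-WINDOW floor of the flowed response (statement `FlowedResponseFloorWindow` of the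
Defs module; NOT proved). -/
theorem stub_window : FlowedResponseFloorWindow := by sorry

/-- Stub 2 (W2 typed once): β-uniform finite-size control of the flowed response (statement
`FlowedResponseFiniteSize` of the Defs module; NOT proved). -/
theorem stub_finiteSize : FlowedResponseFiniteSize := by sorry

/-- The composition: the two registered stubs give the crux (landed `flowedResponseFloor_of_window_of_finiteSize`). -/
theorem FlowedResponseFloor_of : Summit.QuantumFields.YangMills.Theses.GradientFlowWitness.FlowedResponseFloor :=
  flowedResponseFloor_of_window_of_finiteSize stub_window stub_finiteSize

end Summit.QuantumFields.YangMills.Cruxes.FlowedResponseFloor.WindowSplit
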